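import Mathlib
import Literature.NumberTheory.Transcendental.MultipleZetaStuffle
import HarnessLib
import HarnessLib.Audit

/-!
# SoloInformed — quasi-shuffle words (PROGRAMME XLVII, file 1)

Solo programme `solo-KontsevichZagierPeriods-informed`, session s47.

Hoffman's harmonic (stuffle) product `u ∗ v` of two indices is indexed by QUASI-SHUFFLE WORDS:
lattice paths from `(0,0)` to `(|u|,|v|)` with steps `A = (1,0)` (consume the next `u`-block),
`B = (0,1)` (consume the next `v`-block) and `D = (1,1)` (consume both, merged). This file sets up

* the steps `SoloInformedQStep`, the consumption counts `soloInformedCntA/CntB`,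
* the finite set `soloInformedQSh K J` of words consuming `K` `u`-blocks and `J` `v`-blocks, with
  its decompositions by the FIRST step (`soloInformed_sum_qSh_cons`) and by the LAST step
  (`soloInformed_sum_qSh_snoc`),
* the index `soloInformedIdxW u v i j w` read along a word (structural in `w`, with consumption
  counters), and
* the link with the Literature's `MZV.stuffle` (Hoffman's rules (A1)–(A3)):
  `((MZV.stuffle u v).map f).sum = Σ_{w ∈ QSh |u| |v|} f (idxW u v 0 0 w)` (`soloInformed_sum_stuffle_qSh`).

References: Hoffman 1997 §2; Hoffman 2000 (quasi-shuffle products) §2.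
-/

open Literature.NumberTheory.Transcendental

namespace Summit.KontsevichZagierPeriods.KontsevichZagierPeriods.Theorems

/-- The three steps of a quasi-shuffle path. -/
inductive SoloInformedQStep
  | A
  | B
  | D
  deriving DecidableEq, Fintype, Repr

open SoloInformedQStep

/-- Does the step consume a `u`-block? -/
def soloInformedIsA : SoloInformedQStep → Bool
  | A => true
  | B => false
  | D => true

/-- Does the step consume a `v`-block? -/
def soloInformedIsB : SoloInformedQStep → Bool
  | A => false
  | B => true
  | D => true

/-- Number of `u`-blocks consumed by a word. -/
def soloInformedCntA (w : List SoloInformedQStep) : ℕ := w.countP fun s => soloInformedIsA s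

/-- Number of `v`-blocks consumed by a word. -/
def soloInformedCntB (w : List SoloInformedQStep) : ℕ := w.countP fun s => soloInformedIsB s

/-! ## 1. Counting lemmas -/

section counts

/-- `cntA [] = 0`. -/
@[simp] theorem soloInformed_cntA_nil : soloInformedCntA [] = 0 := rfl

/-- `cntB [] = 0`. -/
@[simp] theorem soloInformed_cntB_nil : soloInformedCntB [] = 0 := rfl

/-- `cntA (s :: w)`. -/
@[simp] theorem soloInformed_cntA_cons (s : SoloInformedQStep) (w : List SoloInformedQStep) :
    soloInformedCntA (s :: w) = soloInformedCntA w + if soloInformedIsA s then 1 else 0 := by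
  unfold soloInformedCntA
  rw [List.countP_cons]

/-- `cntB (s :: w)`. -/
@[simp] theorem soloInformed_cntB_cons (s : SoloInformedQStep) (w : List SoloInformedQStep) :
    soloInformedCntB (s :: w) = soloInformedCntB w + if soloInformedIsB s then 1 else 0 := by
  unfold soloInformedCntB
  rw [List.countP_cons]

/-- `cntA (w ++ w')`. -/
@[simp] theorem soloInformed_cntA_append (w w' : List SoloInformedQStep) :
    soloInformedCntA (w ++ w') = soloInformedCntA w + soloInformedCntA w' := by
  unfold soloInformedCntA
  rw [List.countP_append]

/-- `cntB (w ++ w')`. -/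
@[simp] theorem soloInformed_cntB_append (w w' : List SoloInformedQStep) :
    soloInformedCntB (w ++ w') = soloInformedCntB w + soloInformedCntB w' := by
  unfold soloInformedCntB
  rw [List.countP_append]

/-- Every step consumes something: `|w| ≤ cntA w + cntB w`. -/
theorem soloInformed_length_le_cnt : ∀ w : List SoloInformedQStep,
    w.length ≤ soloInformedCntA w + soloInformedCntB w
  | [] => by simp
  | s :: w => by
    have ih := soloInformed_length_le_cnt w
    cases s <;> simp [soloInformedIsA, soloInformedIsB] <;> omega

/-- A word consuming no `u`-block is all `B`. -/
theorem soloInformed_eq_replicate_of_cntA : ∀ w : List SoloInformedQStep,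
    soloInformedCntA w = 0 → w = List.replicate (soloInformedCntB w) B
  | [], _ => by simp
  | s :: w, h => by
    cases s
    · simp [soloInformedIsA] at h
    · simp only [soloInformed_cntA_cons, soloInformedIsA] at h
      simp only [soloInformed_cntB_cons, soloInformedIsB, if_true, List.replicate_succ, List.cons.injEq,
        true_and]
      exact soloInformed_eq_replicate_of_cntA w (by simpa using h)
    · simp [soloInformedIsA] at h

/-- A word consuming no `v`-block is all `A`. -/
theorem soloInformed_eq_replicate_of_cntB : ∀ w : List SoloInformedQStep,
    soloInformedCntB w = 0 → w = List.replicate (soloInformedCntA w) A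
  | [], _ => by simp
  | s :: w, h => by
    cases s
    · simp only [soloInformed_cntB_cons, soloInformedIsB] at h
      simp only [soloInformed_cntA_cons, soloInformedIsA, if_true, List.replicate_succ, List.cons.injEq,
        true_and]
      exact soloInformed_eq_replicate_of_cntB w (by simpa using h)
    · simp [soloInformedIsB] at h
    · simp [soloInformedIsB] at h

/-- Counts of constant words. -/
@[simp] theorem soloInformed_cnt_replicate_A (n : ℕ) :
    soloInformedCntA (List.replicate n A) = n ∧ soloInformedCntB (List.replicate n A) = 0 := by
  induction n with
  | zero => simp
  | succ n ih => simp [List.replicate_succ, ih, soloInformedIsA, soloInformedIsB]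

/-- Counts of constant words. -/
@[simp] theorem soloInformed_cnt_replicate_B (n : ℕ) :
    soloInformedCntA (List.replicate n B) = 0 ∧ soloInformedCntB (List.replicate n B) = n := by
  induction n with
  | zero => simp
  | succ n ih => simp [List.replicate_succ, ih, soloInformedIsA, soloInformedIsB]

end counts

/-! ## 2. The finite set of quasi-shuffle words -/

/-- The words consuming exactly `K` `u`-blocks and `J` `v`-blocks. -/
def soloInformedQSh (K J : ℕ) : Finset (List SoloInformedQStep) :=
  ((Finset.range (K + J + 1)).biUnion fun n =>
      (Finset.univ : Finset (Fin n → SoloInformedQStep)).image List.ofFn).filter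
    fun w => soloInformedCntA w = K ∧ soloInformedCntB w = J

/-- Membership is the pair of counts. -/
theorem soloInformed_mem_qSh {K J : ℕ} {w : List SoloInformedQStep} :
    w ∈ soloInformedQSh K J ↔ soloInformedCntA w = K ∧ soloInformedCntB w = J := by
  refine ⟨fun h => (Finset.mem_filter.1 h).2, fun h => Finset.mem_filter.2 ⟨?_, h⟩⟩
  have hl := soloInformed_length_le_cnt w
  refine Finset.mem_biUnion.2 ⟨w.length, Finset.mem_range.2 (by omega), ?_⟩
  exact Finset.mem_image.2 ⟨fun i => w[(i : ℕ)], Finset.mem_univ _, List.ofFn_getElem (xs := w)⟩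

/-- `QSh 0 J = {B^J}`. -/
theorem soloInformed_qSh_zero_left (J : ℕ) : soloInformedQSh 0 J = {List.replicate J B} := by
  ext w
  rw [soloInformed_mem_qSh, Finset.mem_singleton]
  constructor
  · rintro ⟨hA, hB⟩
    rw [soloInformed_eq_replicate_of_cntA w hA, hB]
  · rintro rfl
    exact soloInformed_cnt_replicate_B J

/-- `QSh K 0 = {A^K}`. -/
theorem soloInformed_qSh_zero_right (K : ℕ) : soloInformedQSh K 0 = {List.replicate K A} := by
  ext w
  rw [soloInformed_mem_qSh, Finset.mem_singleton]
  constructor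
  · rintro ⟨hA, hB⟩
    rw [soloInformed_eq_replicate_of_cntB w hB, hA]
  · rintro rfl
    exact soloInformed_cnt_replicate_A K

section decomp

variable {α : Type*} [AddCommMonoid α]

/-- **Decomposition by the first step.** -/
theorem soloInformed_sum_qSh_cons (K J : ℕ) (φ : List SoloInformedQStep → α) :
    ∑ w ∈ soloInformedQSh (K + 1) (J + 1), φ w =
      ∑ w ∈ soloInformedQSh K (J + 1), φ (A :: w) + ∑ w ∈ soloInformedQSh (K + 1) J, φ (B :: w) +
        ∑ w ∈ soloInformedQSh K J, φ (D :: w) := by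
  have hset : soloInformedQSh (K + 1) (J + 1) =
      ((soloInformedQSh K (J + 1)).image (List.cons A) ∪ (soloInformedQSh (K + 1) J).image (List.cons B)) ∪
        (soloInformedQSh K J).image (List.cons D) := by
    ext w
    simp only [Finset.mem_union, Finset.mem_image, soloInformed_mem_qSh]
    constructor
    · rintro ⟨hA, hB⟩
      cases w with
      | nil => simp at hA
      | cons s w =>
        cases s
        · exact Or.inl (Or.inl ⟨w, ⟨by simpa [soloInformedIsA] using hA, by simpa [soloInformedIsB] using hB⟩, rfl⟩)
        · exact Or.inl (Or.inr ⟨w, ⟨by simpa [soloInformedIsA] using hA, by simpa [soloInformedIsB] using hB⟩, rfl⟩)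
        · exact Or.inr ⟨w, ⟨by simpa [soloInformedIsA] using hA, by simpa [soloInformedIsB] using hB⟩, rfl⟩
    · rintro ((⟨w, ⟨hA, hB⟩, rfl⟩ | ⟨w, ⟨hA, hB⟩, rfl⟩) | ⟨w, ⟨hA, hB⟩, rfl⟩) <;>
        simp [soloInformedIsA, soloInformedIsB, hA, hB]
  have hinj : ∀ s : SoloInformedQStep, Function.Injective (List.cons s) := fun s => List.cons_injective
  have hd1 : Disjoint ((soloInformedQSh K (J + 1)).image (List.cons A))
      ((soloInformedQSh (K + 1) J).image (List.cons B)) :=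
    Finset.disjoint_left.2 fun w h1 h2 => by
      obtain ⟨w1, -, rfl⟩ := Finset.mem_image.1 h1
      obtain ⟨w2, -, h⟩ := Finset.mem_image.1 h2
      simp at h
  have hd2 : Disjoint ((soloInformedQSh K (J + 1)).image (List.cons A) ∪ (soloInformedQSh (K + 1) J).image (List.cons B))
      ((soloInformedQSh K J).image (List.cons D)) :=
    Finset.disjoint_left.2 fun w h1 h2 => by
      obtain ⟨w2, -, rfl⟩ := Finset.mem_image.1 h2
      rcases Finset.mem_union.1 h1 with h1 | h1
      · obtain ⟨w1, -, h⟩ := Finset.mem_image.1 h1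
        simp at h
      · obtain ⟨w1, -, h⟩ := Finset.mem_image.1 h1
        simp at h
  rw [hset, Finset.sum_union hd2, Finset.sum_union hd1, Finset.sum_image fun x _ y _ h => hinj _ h,
    Finset.sum_image fun x _ y _ h => hinj _ h, Finset.sum_image fun x _ y _ h => hinj _ h]

/-- **Decomposition by the last step.** -/
theorem soloInformed_sum_qSh_snoc (K J : ℕ) (φ : List SoloInformedQStep → α) :
    ∑ w ∈ soloInformedQSh (K + 1) (J + 1), φ w =
      ∑ w ∈ soloInformedQSh K (J + 1), φ (w ++ [A]) + ∑ w ∈ soloInformedQSh (K + 1) J, φ (w ++ [B]) +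
        ∑ w ∈ soloInformedQSh K J, φ (w ++ [D]) := by
  have hset : soloInformedQSh (K + 1) (J + 1) =
      ((soloInformedQSh K (J + 1)).image (· ++ [A]) ∪ (soloInformedQSh (K + 1) J).image (· ++ [B])) ∪
        (soloInformedQSh K J).image (· ++ [D]) := by
    ext w
    simp only [Finset.mem_union, Finset.mem_image, soloInformed_mem_qSh]
    constructor
    · rintro ⟨hA, hB⟩
      obtain ⟨w, s, rfl⟩ : ∃ w' s, w = w' ++ [s] := by
        rcases List.eq_nil_or_concat w with rfl | ⟨w', s, rfl⟩
        · simp at hA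
        · exact ⟨w', s, List.concat_eq_append⟩
      cases s
      · exact Or.inl (Or.inl ⟨w, ⟨by simpa [soloInformedIsA] using hA, by simpa [soloInformedIsB] using hB⟩, rfl⟩)
      · exact Or.inl (Or.inr ⟨w, ⟨by simpa [soloInformedIsA] using hA, by simpa [soloInformedIsB] using hB⟩, rfl⟩)
      · exact Or.inr ⟨w, ⟨by simpa [soloInformedIsA] using hA, by simpa [soloInformedIsB] using hB⟩, rfl⟩
    · rintro ((⟨w, ⟨hA, hB⟩, rfl⟩ | ⟨w, ⟨hA, hB⟩, rfl⟩) | ⟨w, ⟨hA, hB⟩, rfl⟩) <;>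
        simp [soloInformedIsA, soloInformedIsB, hA, hB]
  have hinj : ∀ s : SoloInformedQStep, Function.Injective (fun w : List SoloInformedQStep => w ++ [s]) :=
    fun s => List.append_left_injective [s]
  have hd1 : Disjoint ((soloInformedQSh K (J + 1)).image (· ++ [A]))
      ((soloInformedQSh (K + 1) J).image (· ++ [B])) :=
    Finset.disjoint_left.2 fun w h1 h2 => by
      obtain ⟨w1, -, rfl⟩ := Finset.mem_image.1 h1
      obtain ⟨w2, -, h⟩ := Finset.mem_image.1 h2
      have := List.append_inj' h rfl
      simp at this
  have hd2 : Disjoint ((soloInformedQSh K (J + 1)).image (· ++ [A]) ∪ (soloInformedQSh (K + 1) J).image (· ++ [B]))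
      ((soloInformedQSh K J).image (· ++ [D])) :=
    Finset.disjoint_left.2 fun w h1 h2 => by
      obtain ⟨w2, -, rfl⟩ := Finset.mem_image.1 h2
      rcases Finset.mem_union.1 h1 with h1 | h1
      · obtain ⟨w1, -, h⟩ := Finset.mem_image.1 h1
        have := List.append_inj' h rfl
        simp at this
      · obtain ⟨w1, -, h⟩ := Finset.mem_image.1 h1
        have := List.append_inj' h rfl
        simp at this
  rw [hset, Finset.sum_union hd2, Finset.sum_union hd1, Finset.sum_image fun x _ y _ h => hinj _ h,
    Finset.sum_image fun x _ y _ h => hinj _ h, Finset.sum_image fun x _ y _ h => hinj _ h]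

/-- The degenerate sums. -/
theorem soloInformed_sum_qSh_zero_left (J : ℕ) (φ : List SoloInformedQStep → α) :
    ∑ w ∈ soloInformedQSh 0 J, φ w = φ (List.replicate J B) := by
  rw [soloInformed_qSh_zero_left, Finset.sum_singleton]

/-- The degenerate sums. -/
theorem soloInformed_sum_qSh_zero_right (K : ℕ) (φ : List SoloInformedQStep → α) :
    ∑ w ∈ soloInformedQSh K 0, φ w = φ (List.replicate K A) := by
  rw [soloInformed_qSh_zero_right, Finset.sum_singleton]

end decomp

/-! ## 3. The index read along a word, and Hoffman's product -/

/-- The index of the word `w` on `(u, v)`, having already consumed `i` `u`-blocks and `j`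
`v`-blocks: an `A` step contributes `u_i`, a `B` step `v_j`, a `D` step `u_i + v_j`. -/
def soloInformedIdxW (u v : List ℕ) : ℕ → ℕ → List SoloInformedQStep → List ℕ
  | _, _, [] => []
  | i, j, A :: w => u.getD i 0 :: soloInformedIdxW u v (i + 1) j w
  | i, j, B :: w => v.getD j 0 :: soloInformedIdxW u v i (j + 1) w
  | i, j, D :: w => (u.getD i 0 + v.getD j 0) :: soloInformedIdxW u v (i + 1) (j + 1) w

/-- Shifting the `u`-counter absorbs a head letter of `u`. -/
theorem soloInformed_idxW_cons_left (a : ℕ) (u v : List ℕ) :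
    ∀ (w : List SoloInformedQStep) (i j : ℕ),
      soloInformedIdxW (a :: u) v (i + 1) j w = soloInformedIdxW u v i j w
  | [], _, _ => rfl
  | s :: w, i, j => by
    cases s <;> simp only [soloInformedIdxW, List.getD_cons_succ, soloInformed_idxW_cons_left a u v w]

/-- Shifting the `v`-counter absorbs a head letter of `v`. -/
theorem soloInformed_idxW_cons_right (b : ℕ) (u v : List ℕ) :
    ∀ (w : List SoloInformedQStep) (i j : ℕ),
      soloInformedIdxW u (b :: v) i (j + 1) w = soloInformedIdxW u v i j w
  | [], _, _ => rfl
  | s :: w, i, j => by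
    cases s <;> simp only [soloInformedIdxW, List.getD_cons_succ, soloInformed_idxW_cons_right b u v w]

/-- Reading `B^n` lists `v`. -/
theorem soloInformed_idxW_replicate_B (u : List ℕ) : ∀ (v : List ℕ),
    soloInformedIdxW u v 0 0 (List.replicate v.length B) = v
  | [] => rfl
  | b :: v => by
    rw [List.length_cons, List.replicate_succ, soloInformedIdxW, List.getD_cons_zero,
      soloInformed_idxW_cons_right, soloInformed_idxW_replicate_B u v]

/-- Reading `A^n` lists `u`. -/
theorem soloInformed_idxW_replicate_A (v : List ℕ) : ∀ (u : List ℕ),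
    soloInformedIdxW u v 0 0 (List.replicate u.length A) = u
  | [] => rfl
  | a :: u => by
    rw [List.length_cons, List.replicate_succ, soloInformedIdxW, List.getD_cons_zero,
      soloInformed_idxW_cons_left, soloInformed_idxW_replicate_A v u]

/-- **Hoffman's product is the sum over quasi-shuffle words.** For any `f` into an additive
commutative monoid, `Σ_{x ∈ u ∗ v} f x = Σ_{w ∈ QSh |u| |v|} f (idxW u v 0 0 w)`.
[Hoffman 1997 §2 (A1)–(A3); Hoffman 2000 §2] -/
theorem soloInformed_sum_stuffle_qSh {α : Type*} [AddCommMonoid α] (f : List ℕ → α) :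
    ∀ (u v : List ℕ), ((MZV.stuffle u v).map f).sum =
      ∑ w ∈ soloInformedQSh u.length v.length, f (soloInformedIdxW u v 0 0 w)
  | [], v => by
    rw [MZV.stuffle_nil_left, List.length_nil, soloInformed_sum_qSh_zero_left, soloInformed_idxW_replicate_B]
    simp
  | a :: u, [] => by
    rw [MZV.stuffle_nil_right, List.length_nil, soloInformed_sum_qSh_zero_right, soloInformed_idxW_replicate_A]
    simp
  | a :: u, b :: v => by
    rw [MZV.stuffle_cons_cons, List.map_append, List.map_append, List.sum_append, List.sum_append]
    simp only [List.map_map]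
    rw [soloInformed_sum_stuffle_qSh (f ∘ List.cons a) u (b :: v),
      soloInformed_sum_stuffle_qSh (f ∘ List.cons b) (a :: u) v,
      soloInformed_sum_stuffle_qSh (f ∘ List.cons (a + b)) u v, List.length_cons, List.length_cons,
      soloInformed_sum_qSh_cons]
    simp only [Function.comp_apply, soloInformedIdxW, List.getD_cons_zero, soloInformed_idxW_cons_left,
      soloInformed_idxW_cons_right, Nat.zero_add]
    rw [add_assoc]
termination_by u v => u.length + v.length

/-- Smoke test: `(2) ∗ (2,1)` has `|QSh 1 2| = 5` words. -/
example : (soloInformedQSh 1 2).card = 5 := by decide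

end Summit.KontsevichZagierPeriods.KontsevichZagierPeriods.Theorems
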